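import Summits.QuantumFields.YangMills.Theorems.UnitScaleTiltProp7OneFormGarding
import Summits.QuantumFields.YangMills.Theorems.UnitScaleTiltProp7MassivePropagatorCoercive
import Summits.QuantumFields.YangMills.Theorems.UnitScaleTiltProp7BlockDistanceWeights
import HarnessLib

/-!
# Route `UnitScaleTilt`, crux K1 «MinimiserStabilityRegPr» (stmt-QuantumFields-19200), EX face S45 — (L3′b)-VALUE, ONE-FORM STOREY, pen (P-1FA) «ONE-FORM AGMON», FILE A2a:
# **THE MIXED FORM IDENTITY OF `Δ_a = Δx + D R_S D* + a·Q_k†Q_k` AND THE SCHUR LETTER FOR A DISPLAYED BLOCK-DECAYING KERNEL** — the two carrier-free tools of the `hVconj`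
# letter of A3 ✓∕⧗`Prop7OneFormAgmon.agmon_oneForm_of_letters` (the conjugation defect `θ_V` of `V := Δ_a − D†D` under a positive weight)

Cell `ym3-torus` (HUMAN RULING D-0037; rung R3 = SU(2) YM₃ on T³ — NOT d = 4, NOT infinite volume, NOT a mass gap, NOT Clay).  Width seat `ym3-torus-px21` (gen 14);
★p1 g26 CHAIR WORD №6 SPLIT: A1 ✓`Prop7OneFormGarding` (chair), A2 = px21 (THIS series), A3 ✓∕⧗`Prop7OneFormAgmon` (chair; its hypothesis `hVconj` is the export of this series).
THEOREMS ONLY (0 `def`, 0 `sorry`); `--supports stmt-QuantumFields-19200 --as helper`; count-neutral.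

WHY.  A3 runs A1's ✓`agmon_bound_of_garding` at `T := Δ_a`, `V := Δ_a − D†D` (Kato gradient `D` componentwise) and DISPLAYS `hVconj : re⟪v, Vv⟫ − θ_V‖v‖² ≤ re⟪Mv, V(M⁻¹v)⟫`
(`M = w(b₋)·`).  By A1 ✓`inner_laplaceA_eq` (O1 integrated), `V = η⁻²(Δ′₁ − 𝒦) + (Δx − Δ^η) − D(1 − R_S)D* + a·Q_k†Q_k` IN FORM — the `DD*` of `Δ^η` is inside the Kato part (Weitzenböck), so NO
`D*` defect is needed.  To compare the conjugated and unconjugated forms one needs the identity with TWO fields (§3, the mixed edition of A1's) and, for the nonlocal `D(1−R_S)D*` — which is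
`L²`-BOUNDED (`= (DP)(DP)†`) with the pointwise kernel `Ck·e^{−μ′·tdist}` of the EX row `h349` (V6 ✓`Prop7ComplementaryProjectorGradientKernel` + (ii-c) ✓p764569) — Schur's test against
the weight's far ratios (§4).  §0 is the three-term bound showing that FIRST-ORDER (norm) letters suffice for every `S†S`-type piece.
WHAT IS PROVED (ns `Summit.QuantumFields.YangMills.Theorems.Prop7OneFormAgmonLetters`; member `F`, `n K`, weight `c₀`; ANY background `U₀` — no `RegPr` in this file).
* §0 `abs_re_inner_add_add_sub_sq_le` — `|re⟪a + k, a + k′⟫ − ‖a‖²| ≤ ‖a‖t + s‖a‖ + st` for `‖k‖ ≤ s`, `‖k′‖ ≤ t`.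
* §3 ★★ `inner_laplaceA_eq₂ (U₀ X′ X″)` — `⟪toL2 X′, Δ_a(toL2 X″)⟫ = Σ_μ⟪D X′_μ, D X″_μ⟫ + ⟪toL2 X′, toL2(η⁻²(Δ′₁−𝒦)X″)⟫ + ⟪toL2 X′,(Δx−Δ^η)(toL2 X″)⟫ − ⟪toL2 X′, D(D*(toL2X″) − R_S D*(toL2X″))⟫ + a·⟪Q_k(toL2X′), Q_k(toL2X″)⟫`.
* §4 `sum_sum_mul_le_of_row_le` (Schur, symmetric kernel), `sum_pbond_exp_neg_mul_tdist_le` (`Σ_b e^{−c·tdist(Bx, Bb₋)} ≤ d·(L^d)^{K−n}·(2(1+1∕c))³`),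
  ★★ `abs_re_inner_conj_kernel_sub_le` — for ANY linear `B` with the kernel row `‖toL2⁻¹(B(toL2(δ_b⊗Z)))(bd)‖ ≤ Ck·e^{−μ′·tdist(B b₋, B bd₋)}·‖Z‖` and a weight with far ratios
  `|w x∕w x′ − 1| ≤ θc·e^{ν·tdist(Bx,Bx′)}`, `ν < μ′`: `|re⟪toL2(w(b₋)·X), B(toL2(w(b₋)⁻¹·X))⟫ − re⟪toL2 X, B(toL2 X)⟫| ≤ √2·Ck·θc·(d·(L^d)^{K−n}·(2(1+1∕(μ′−ν)))³)·‖toL2 X‖²` — K-FREE at the pin `Ck ∝ ℓ⁻³`.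
HYP-SAT (★★OWNER RULING №42): §0∕§3 identities ∕ pure algebra for EVERY `U₀`, slot, `a`, `w > 0`; §4's `hk` is the MEMBER TEXT of the EX row `h349` with a free constant (inhabited under Lift
by ✓V6 + ✓p764569 with `Ck = C₃₄₉·ℓ⁻³`), `hwfar` is inhabited by `w = e^{φ}` with `φ` coarse-Lipschitz (e.g. px12 ✓`exists_blockDistanceWeight` rows + `t ≤ e^{βt}∕β`); nothing eventual; no
hypothesis restates a conclusion.  HONEST SCOPE.  Algebra + Schur bookkeeping; nothing of (P-1FA)'s export, the ten EX rows, `hT`, (3.46)∕Thm 3.12 for print's operators, EX or the crux is proved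
here; the Yang–Mills mass gap is NOT proved.

References: T. Bałaban, CMP **99** (1985) 389–434 [Balaban1985BackgroundPropagators] ((3.3) p.391, (3.11) p.392, (3.13)–(3.16) p.393, (3.21)–(3.26) pp.394–395, Thm 3.1 (3.46) p.398,
(3.49) p.399, Thm 3.12 p.422); CMP **102** (1985) 277–309 [Balaban1985Variational] ((44)–(45) p.285, (134)–(136) p.298); CMP **95** (1984) 17–40 [Balaban1984PropagatorsI] ((1.18) p.20);
S. Agmon, *Lectures on exponential decay of solutions of second-order elliptic equations* (Princeton 1982) Ch. 1 [Agmon1982].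
-/

set_option autoImplicit false

noncomputable section

open scoped BigOperators Matrix.Norms.L2Operator InnerProductSpace ComplexConjugate

namespace Summit.QuantumFields.YangMills.Theorems.Prop7OneFormAgmonLetters

open Literature.MathematicalPhysics.QuantumFieldTheory.Balaban1983to89
open Literature.MathematicalPhysics.QuantumFieldTheory.Balaban1983to89.T3ContinuumYM3Torus
open T3SectALandauChart (eta eta_pos bgUnits formComp)
open B9TorusCalculus (torusT)
open B9Eq310Hermitian (deltaPrimeOp)
open B11Eq135Weitzenbock (curvOp)
open B11Eq103H1Complex (SiteL2K BondL2K)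
open B9Eq39Adjoint (R)
open B5Eq118OneStroke (iterBlockOf)
open Summit.QuantumFields.YangMills.Theorems.Prop7SectET3Transport (periodsT3 siteEquiv bondEquiv)
open Summit.QuantumFields.YangMills.Theorems.Prop7SectET3HilbertLetters (W₂ frobEquiv toL2 toL2S DL2 DstarL2 covLapSite adjoint_DL2 inner_toL2 inner_covLapSite)
open Summit.QuantumFields.YangMills.Theorems.Prop7SectET3WilsonHessian (DeltaEta DeltaEtaSlot)
open Summit.QuantumFields.YangMills.Theorems.Prop7SectET3GaugeProjector (RS RS_eq_projR)
open Summit.QuantumFields.YangMills.Theorems.Prop7SectET3CurvedPropagators (laplaceA Qk)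
open Summit.QuantumFields.YangMills.Theorems.Prop7SectET3DeltaEtaExplicit (sum_pbond_eq)
open Summit.QuantumFields.YangMills.Theorems.Prop7RieszTauFrobNorm (norm_sq_frobEquiv_symm norm_le_norm_frobEquiv_symm norm_frobEquiv_symm_le)
open Summit.QuantumFields.YangMills.Theorems.Prop7LaplaceAFlatLetters (norm_sq_toL2 norm_sq_toL2S)
open Summit.QuantumFields.YangMills.Theorems.Prop7BlockBumpExtension (sum_comp_iterBlockOf)
open Summit.QuantumFields.YangMills.Theorems.Prop7BlockDistanceWeights (sum_exp_neg_mul_tdist_coarse_le tdist_coarse_comm eta_mul_pow_eq_one)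
open Summit.QuantumFields.YangMills.Theorems.Prop7MassivePropagatorAgmonLetters (inner_toL2S_smul_left inner_toL2_smul_left inner_toL2S_smul_smul_inv
  inner_toL2_smul_smul_inv DL2_smul_eq_smul_add_defect normSq_gradDefect_le)
open Summit.QuantumFields.YangMills.Theorems.Prop7OneFormKatoForm (covLapSite_toL2S_formComp_eq)
open Summit.QuantumFields.YangMills.Theorems.Prop7OneFormGarding (sum_inner_toL2S_formComp)

/-! ## §0 The abstract three-term bound -/

/-- **FIRST-ORDER LETTERS SUFFICE**: in any inner product space, `|re⟪a + k, a + k′⟫ − ‖a‖²| ≤ ‖a‖·t + s·‖a‖ + s·t` once `‖k‖ ≤ s`, `‖k′‖ ≤ t`. [folklore] [cite: Agmon1982, Ch. 1] -/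
theorem abs_re_inner_add_add_sub_sq_le {E : Type*} [NormedAddCommGroup E] [InnerProductSpace ℂ E] (a k k' : E) {s t : ℝ}
    (hk : ‖k‖ ≤ s) (hk' : ‖k'‖ ≤ t) :
    |RCLike.re ⟪a + k, a + k'⟫_ℂ - ‖a‖ ^ 2| ≤ ‖a‖ * t + s * ‖a‖ + s * t := by
  have hs : 0 ≤ s := (norm_nonneg _).trans hk
  have e : ⟪a + k, a + k'⟫_ℂ = ⟪a, a⟫_ℂ + (⟪a, k'⟫_ℂ + ⟪k, a⟫_ℂ + ⟪k, k'⟫_ℂ) := by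
    rw [inner_add_left, inner_add_right, inner_add_right]; ring
  rw [e, map_add, ← @norm_sq_eq_re_inner ℂ, add_sub_cancel_left, map_add, map_add]
  refine (abs_add_le _ _).trans (add_le_add ((abs_add_le _ _).trans (add_le_add ?_ ?_)) ?_)
  · exact (RCLike.abs_re_le_norm _).trans ((norm_inner_le_norm _ _).trans (mul_le_mul_of_nonneg_left hk' (norm_nonneg _)))
  · exact (RCLike.abs_re_le_norm _).trans ((norm_inner_le_norm _ _).trans (mul_le_mul_of_nonneg_right hk (norm_nonneg _)))
  · exact (RCLike.abs_re_le_norm _).trans ((norm_inner_le_norm _ _).trans (mul_le_mul hk hk' (norm_nonneg _) hs))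

/-! ## §3 The mixed form identity of `Δ_a` (A1's `inner_laplaceA_eq` with two different bond fields) -/

section Mixed

variable {F : T3Family} {n K : ℕ} {c₀ : ℝ} [Fact (0 < c₀)] {h : n ≤ K} {cB a : ℝ} [Fact (0 < cB)]
  {Δx : GaugeField (F.P K) 0 (Matrix.specialUnitaryGroup (Fin 2) ℂ) → (BondL2K ℂ 3 (periodsT3 F K) c₀ W₂ →ₗ[ℂ] BondL2K ℂ 3 (periodsT3 F K) c₀ W₂)}

/-- ★★ **THE MIXED FORM IDENTITY OF `Δ_a`** (A1 ✓`Prop7OneFormGarding.inner_laplaceA_eq` with two bond fields `X′`, `X″`): for EVERY background, slot, coupling,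
`⟪toL2 X′, Δ_a(toL2 X″)⟫ = Σ_μ ⟪D_{U₀}(toL2S X′_μ), D_{U₀}(toL2S X″_μ)⟫ + ⟪toL2 X′, toL2(η⁻²(Δ′₁ − 𝒦)X″)⟫ + ⟪toL2 X′, (Δx − Δ^η)(toL2 X″)⟫ − ⟪toL2 X′, D(D*(toL2 X″) − R_S D*(toL2 X″))⟫ + a·⟪Q_k(toL2 X′), Q_k(toL2 X″)⟫`
— the Kato pairing, the local pairing, the slot, the complementary-projector pairing (kept as an OPERATOR applied to `X″`, for the kernel road), the averaging pairing
(px5 g12 ✓`covLapSite_toL2S_formComp_eq` per component + ✓`adjoint_DL2` + `LinearMap.adjoint_inner_right`).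
[cite: Balaban1985Variational, (134)–(135) p.298; Balaban1985BackgroundPropagators, (3.26) p.395, (3.23) p.394] -/
theorem inner_laplaceA_eq₂ (U₀ : GaugeField (F.P K) 0 (Matrix.specialUnitaryGroup (Fin 2) ℂ)) (X' X'' : PBond (F.P K) 0 → Matrix (Fin 2) (Fin 2) ℂ) :
    ⟪toL2 F K c₀ X', laplaceA F n K h c₀ cB a Δx U₀ (toL2 F K c₀ X'')⟫_ℂ
      = (∑ μ : Fin (F.P K).d, ⟪DL2 F n K c₀ U₀ (toL2S F K c₀ (formComp X' μ)), DL2 F n K c₀ U₀ (toL2S F K c₀ (formComp X'' μ))⟫_ℂ)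
        + ⟪toL2 F K c₀ X', toL2 F K c₀ (fun b : PBond (F.P K) 0 => (eta F n K)⁻¹ • (eta F n K)⁻¹ •
            (deltaPrimeOp (torusT (F.P K) 0) (fun μ x => bgUnits F K U₀ ⟨x, μ⟩) 1 (formComp X'') b.dir b.src
              - curvOp (torusT (F.P K) 0) (fun μ x => bgUnits F K U₀ ⟨x, μ⟩) (formComp X'') b.dir b.src))⟫_ℂ
        + ⟪toL2 F K c₀ X', (Δx U₀ - (DeltaEta F n K c₀ U₀ : BondL2K ℂ 3 (periodsT3 F K) c₀ W₂ →ₗ[ℂ] BondL2K ℂ 3 (periodsT3 F K) c₀ W₂)) (toL2 F K c₀ X'')⟫_ℂ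
        - ⟪toL2 F K c₀ X', DL2 F n K c₀ U₀ (DstarL2 F n K c₀ U₀ (toL2 F K c₀ X'') - RS F n K h c₀ cB U₀ (DstarL2 F n K c₀ U₀ (toL2 F K c₀ X'')))⟫_ℂ
        + ((a : ℝ) : ℂ) * ⟪Qk F n K h c₀ cB U₀ (toL2 F K c₀ X'), Qk F n K h c₀ cB U₀ (toL2 F K c₀ X'')⟫_ℂ := by
  set v' := toL2 F K c₀ X' with hv'
  set v := toL2 F K c₀ X'' with hv
  set Y : PBond (F.P K) 0 → Matrix (Fin 2) (Fin 2) ℂ := (toL2 F K c₀).symm (laplaceA F n K h c₀ cB a Δx U₀ v) with hY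
  have hXY : laplaceA F n K h c₀ cB a Δx U₀ (toL2 F K c₀ X'') = toL2 F K c₀ Y := by rw [hY, LinearEquiv.apply_symm_apply]
  -- the pairing with `Y` through the components
  have hlhs : ⟪v', laplaceA F n K h c₀ cB a Δx U₀ v⟫_ℂ = ∑ μ : Fin (F.P K).d, ⟪toL2S F K c₀ (formComp X' μ), toL2S F K c₀ (formComp Y μ)⟫_ℂ := by
    rw [sum_inner_toL2S_formComp, ← hXY]
  -- per component: `⟪X′_μ, Y_μ⟫ = ⟪D X′_μ, D X″_μ⟫ + ⟪X′_μ, q_μ⟫`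
  have hcomp : ∀ μ : Fin (F.P K).d, ⟪toL2S F K c₀ (formComp X' μ), toL2S F K c₀ (formComp Y μ)⟫_ℂ
      = ⟪DL2 F n K c₀ U₀ (toL2S F K c₀ (formComp X' μ)), DL2 F n K c₀ U₀ (toL2S F K c₀ (formComp X'' μ))⟫_ℂ
        + ⟪toL2S F K c₀ (formComp X' μ), toL2S F K c₀ (fun x : Site (F.P K) 0 =>
            (eta F n K)⁻¹ • (eta F n K)⁻¹ •
              (deltaPrimeOp (torusT (F.P K) 0) (fun μ x => bgUnits F K U₀ ⟨x, μ⟩) 1 (formComp X'') μ x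
                - curvOp (torusT (F.P K) 0) (fun μ x => bgUnits F K U₀ ⟨x, μ⟩) (formComp X'') μ x)
            + (toL2 F K c₀).symm ((Δx U₀ - (DeltaEta F n K c₀ U₀ : BondL2K ℂ 3 (periodsT3 F K) c₀ W₂ →ₗ[ℂ] BondL2K ℂ 3 (periodsT3 F K) c₀ W₂)) (toL2 F K c₀ X'')) ⟨x, μ⟩
            - (toL2 F K c₀).symm (DL2 F n K c₀ U₀ (DstarL2 F n K c₀ U₀ (toL2 F K c₀ X'') - RS F n K h c₀ cB U₀ (DstarL2 F n K c₀ U₀ (toL2 F K c₀ X'')))) ⟨x, μ⟩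
            + (toL2 F K c₀).symm (LinearMap.adjoint (Qk F n K h c₀ cB U₀) (((a : ℝ) : ℂ) • Qk F n K h c₀ cB U₀ (toL2 F K c₀ X''))) ⟨x, μ⟩)⟫_ℂ := by
    intro μ
    have hc := covLapSite_toL2S_formComp_eq (F := F) (h := h) (c₀ := c₀) (cB := cB) (a := a) (Δx := Δx) (U₀ := U₀) X'' Y hXY μ
    have hkato : ⟪toL2S F K c₀ (formComp X' μ), covLapSite F n K c₀ U₀ (toL2S F K c₀ (formComp X'' μ))⟫_ℂ
        = ⟪DL2 F n K c₀ U₀ (toL2S F K c₀ (formComp X' μ)), DL2 F n K c₀ U₀ (toL2S F K c₀ (formComp X'' μ))⟫_ℂ := by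
      rw [Summit.QuantumFields.YangMills.Theorems.Prop7SectET3HilbertLetters.covLapSite, LinearMap.comp_apply, ← adjoint_DL2, LinearMap.adjoint_inner_right]
    rw [← hkato, hc, inner_sub_right, sub_add_cancel]
  -- the four remainder pairings summed over the components are bond pairings
  have hsumq : ∑ μ : Fin (F.P K).d, ⟪toL2S F K c₀ (formComp X' μ), toL2S F K c₀ (fun x : Site (F.P K) 0 =>
            (eta F n K)⁻¹ • (eta F n K)⁻¹ •
              (deltaPrimeOp (torusT (F.P K) 0) (fun μ x => bgUnits F K U₀ ⟨x, μ⟩) 1 (formComp X'') μ x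
                - curvOp (torusT (F.P K) 0) (fun μ x => bgUnits F K U₀ ⟨x, μ⟩) (formComp X'') μ x)
            + (toL2 F K c₀).symm ((Δx U₀ - (DeltaEta F n K c₀ U₀ : BondL2K ℂ 3 (periodsT3 F K) c₀ W₂ →ₗ[ℂ] BondL2K ℂ 3 (periodsT3 F K) c₀ W₂)) (toL2 F K c₀ X'')) ⟨x, μ⟩
            - (toL2 F K c₀).symm (DL2 F n K c₀ U₀ (DstarL2 F n K c₀ U₀ (toL2 F K c₀ X'') - RS F n K h c₀ cB U₀ (DstarL2 F n K c₀ U₀ (toL2 F K c₀ X'')))) ⟨x, μ⟩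
            + (toL2 F K c₀).symm (LinearMap.adjoint (Qk F n K h c₀ cB U₀) (((a : ℝ) : ℂ) • Qk F n K h c₀ cB U₀ (toL2 F K c₀ X''))) ⟨x, μ⟩)⟫_ℂ
      = ⟪v', toL2 F K c₀ (fun b : PBond (F.P K) 0 => (eta F n K)⁻¹ • (eta F n K)⁻¹ •
            (deltaPrimeOp (torusT (F.P K) 0) (fun μ x => bgUnits F K U₀ ⟨x, μ⟩) 1 (formComp X'') b.dir b.src
              - curvOp (torusT (F.P K) 0) (fun μ x => bgUnits F K U₀ ⟨x, μ⟩) (formComp X'') b.dir b.src))⟫_ℂ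
        + ⟪v', (Δx U₀ - (DeltaEta F n K c₀ U₀ : BondL2K ℂ 3 (periodsT3 F K) c₀ W₂ →ₗ[ℂ] BondL2K ℂ 3 (periodsT3 F K) c₀ W₂)) v⟫_ℂ
        - ⟪v', DL2 F n K c₀ U₀ (DstarL2 F n K c₀ U₀ v - RS F n K h c₀ cB U₀ (DstarL2 F n K c₀ U₀ v))⟫_ℂ
        + ⟪v', LinearMap.adjoint (Qk F n K h c₀ cB U₀) (((a : ℝ) : ℂ) • Qk F n K h c₀ cB U₀ v)⟫_ℂ := by
    have hμ : ∀ μ : Fin (F.P K).d, (fun x : Site (F.P K) 0 =>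
            (eta F n K)⁻¹ • (eta F n K)⁻¹ •
              (deltaPrimeOp (torusT (F.P K) 0) (fun μ x => bgUnits F K U₀ ⟨x, μ⟩) 1 (formComp X'') μ x
                - curvOp (torusT (F.P K) 0) (fun μ x => bgUnits F K U₀ ⟨x, μ⟩) (formComp X'') μ x)
            + (toL2 F K c₀).symm ((Δx U₀ - (DeltaEta F n K c₀ U₀ : BondL2K ℂ 3 (periodsT3 F K) c₀ W₂ →ₗ[ℂ] BondL2K ℂ 3 (periodsT3 F K) c₀ W₂)) (toL2 F K c₀ X'')) ⟨x, μ⟩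
            - (toL2 F K c₀).symm (DL2 F n K c₀ U₀ (DstarL2 F n K c₀ U₀ (toL2 F K c₀ X'') - RS F n K h c₀ cB U₀ (DstarL2 F n K c₀ U₀ (toL2 F K c₀ X'')))) ⟨x, μ⟩
            + (toL2 F K c₀).symm (LinearMap.adjoint (Qk F n K h c₀ cB U₀) (((a : ℝ) : ℂ) • Qk F n K h c₀ cB U₀ (toL2 F K c₀ X''))) ⟨x, μ⟩)
        = formComp ((toL2 F K c₀).symm (toL2 F K c₀ (fun b : PBond (F.P K) 0 => (eta F n K)⁻¹ • (eta F n K)⁻¹ •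
            (deltaPrimeOp (torusT (F.P K) 0) (fun μ x => bgUnits F K U₀ ⟨x, μ⟩) 1 (formComp X'') b.dir b.src
              - curvOp (torusT (F.P K) 0) (fun μ x => bgUnits F K U₀ ⟨x, μ⟩) (formComp X'') b.dir b.src))
            + (Δx U₀ - (DeltaEta F n K c₀ U₀ : BondL2K ℂ 3 (periodsT3 F K) c₀ W₂ →ₗ[ℂ] BondL2K ℂ 3 (periodsT3 F K) c₀ W₂)) v
            - DL2 F n K c₀ U₀ (DstarL2 F n K c₀ U₀ v - RS F n K h c₀ cB U₀ (DstarL2 F n K c₀ U₀ v))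
            + LinearMap.adjoint (Qk F n K h c₀ cB U₀) (((a : ℝ) : ℂ) • Qk F n K h c₀ cB U₀ v))) μ := by
      intro μ
      funext x
      simp only [formComp, map_add, map_sub, LinearEquiv.symm_apply_apply, Pi.add_apply, Pi.sub_apply, hv]
    simp only [hμ]
    rw [sum_inner_toL2S_formComp, LinearEquiv.apply_symm_apply, inner_add_right, inner_sub_right, inner_add_right]
  -- the penalty pairing
  have hQ : ⟪v', LinearMap.adjoint (Qk F n K h c₀ cB U₀) (((a : ℝ) : ℂ) • Qk F n K h c₀ cB U₀ v)⟫_ℂ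
      = ((a : ℝ) : ℂ) * ⟪Qk F n K h c₀ cB U₀ v', Qk F n K h c₀ cB U₀ v⟫_ℂ := by
    rw [LinearMap.adjoint_inner_right, inner_smul_right]
  rw [hlhs, Finset.sum_congr rfl fun μ _ => hcomp μ, Finset.sum_add_distrib, hsumq, hQ]
  abel

end Mixed

/-! ## §4 The Schur letter: a displayed pointwise kernel row decaying in the block distance, conjugated by the weight -/

section Schur

/-- **SCHUR's TEST, symmetric edition**: `K ≥ 0` symmetric with row sums `≤ R` ⟹ `Σ_{ij} K_{ij}·f_i f_j ≤ R·Σ_i f_i²`. [folklore] -/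
theorem sum_sum_mul_le_of_row_le {ι : Type*} [Fintype ι] (Kf : ι → ι → ℝ) (hK0 : ∀ i j, 0 ≤ Kf i j) (hsymm : ∀ i j, Kf i j = Kf j i)
    {Rr : ℝ} (hrow : ∀ i, ∑ j, Kf i j ≤ Rr) (f : ι → ℝ) :
    ∑ i, ∑ j, Kf i j * (f i * f j) ≤ Rr * ∑ i, f i ^ 2 := by
  have h1 : ∑ i, ∑ j, Kf i j * (f i * f j) ≤ ∑ i, ∑ j, (Kf i j * f i ^ 2 / 2 + Kf i j * f j ^ 2 / 2) :=
    Finset.sum_le_sum fun i _ => Finset.sum_le_sum fun j _ => by nlinarith [hK0 i j, sq_nonneg (f i - f j)]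
  have h2 : ∑ i, ∑ j, (Kf i j * f i ^ 2 / 2 + Kf i j * f j ^ 2 / 2) = ∑ i, (f i ^ 2 * ∑ j, Kf i j) := by
    rw [Finset.sum_congr rfl fun i _ => Finset.sum_add_distrib, Finset.sum_add_distrib]
    have hA : ∑ i, ∑ j, Kf i j * f i ^ 2 / 2 = ∑ i, (f i ^ 2 * ∑ j, Kf i j) / 2 := by
      refine Finset.sum_congr rfl fun i _ => ?_
      rw [Finset.mul_sum, Finset.sum_div]
      exact Finset.sum_congr rfl fun j _ => by ring
    have hB : ∑ i, ∑ j, Kf i j * f j ^ 2 / 2 = ∑ j, (f j ^ 2 * ∑ i, Kf j i) / 2 := by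
      rw [Finset.sum_comm]
      refine Finset.sum_congr rfl fun j _ => ?_
      rw [Finset.mul_sum, Finset.sum_div]
      exact Finset.sum_congr rfl fun i _ => by rw [hsymm i j]; ring
    rw [hA, hB, ← Finset.sum_add_distrib]
    exact Finset.sum_congr rfl fun i _ => by ring
  rw [h2] at h1
  calc ∑ i, ∑ j, Kf i j * (f i * f j) ≤ ∑ i, (f i ^ 2 * ∑ j, Kf i j) := h1
    _ ≤ ∑ i, f i ^ 2 * Rr := Finset.sum_le_sum fun i _ => mul_le_mul_of_nonneg_left (hrow i) (sq_nonneg _)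
    _ = Rr * ∑ i, f i ^ 2 := by rw [← Finset.sum_mul, mul_comm]

variable (F : T3Family) {n K : ℕ} {c₀ : ℝ} [Fact (0 < c₀)]

/-- **THE BOND ROW SUM OF THE BLOCK-DISTANCE DECAY FACTOR**: `Σ_b e^{−c·tdist(B x, B b₋)} ≤ d·(L^d)^{K−n}·(2(1 + 1∕c))³` (`c > 0`; `d` directions per source, `(L^d)^{K−n}` sites per
block ✓`sum_comp_iterBlockOf`, the K-∕volume-free coarse sum px12 ✓`sum_exp_neg_mul_tdist_coarse_le`). [cite: Balaban1985BackgroundPropagators, (3.49) p.399] -/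
theorem sum_pbond_exp_neg_mul_tdist_le {c : ℝ} (hc : 0 < c) (x : Site (F.P K) 0) :
    ∑ b : PBond (F.P K) 0, Real.exp (-(c * (Site.tdist (P := F.P K) (iterBlockOf (K - n) x) (iterBlockOf (K - n) b.src) : ℝ)))
      ≤ ((F.P K).d : ℝ) * ((((F.P K).L : ℝ) ^ (F.P K).d) ^ (K - n)) * (2 * (1 + 1 / c)) ^ 3 := by
  have hk : K - n ≤ (F.P K).m + (F.P K).K := by show K - n ≤ F.m + K; have := F.hm; omega
  rw [sum_pbond_eq]
  have hinner : ∀ y : Site (F.P K) 0, ∑ μ : Fin (F.P K).d, Real.exp (-(c * (Site.tdist (P := F.P K) (iterBlockOf (K - n) x) (iterBlockOf (K - n) y) : ℝ)))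
      = ((F.P K).d : ℝ) * Real.exp (-(c * (Site.tdist (P := F.P K) (iterBlockOf (K - n) x) (iterBlockOf (K - n) y) : ℝ))) := fun y => by
    rw [Finset.sum_const, Finset.card_univ, Fintype.card_fin, nsmul_eq_mul]
  rw [Finset.sum_congr rfl fun y _ => hinner y, ← Finset.mul_sum,
    sum_comp_iterBlockOf hk (fun z : Site (F.P K) (K - n) => Real.exp (-(c * (Site.tdist (P := F.P K) (iterBlockOf (K - n) x) z : ℝ)))), mul_assoc]
  refine mul_le_mul_of_nonneg_left (mul_le_mul_of_nonneg_left ?_ (by have := (F.P K).L_pos; positivity)) (Nat.cast_nonneg _)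
  have hc' : ∀ z : Site (F.P K) (K - n), Real.exp (-(c * (Site.tdist (P := F.P K) (iterBlockOf (K - n) x) z : ℝ)))
      = Real.exp (-(c * (Site.tdist (P := F.P K) z (iterBlockOf (K - n) x) : ℝ))) := fun z => by rw [tdist_coarse_comm F]
  rw [Finset.sum_congr rfl fun z _ => hc' z]
  exact sum_exp_neg_mul_tdist_coarse_le F hc _

/-- ★★ **THE SCHUR LETTER**: for ANY linear `B` on the fine vector fields with a DISPLAYED pointwise kernel row decaying in the block distance of the sources
(`hk`, the MEMBER TEXT of the EX row `h349`∕V6 ✓`Prop7ComplementaryProjectorGradientKernel.norm_equiv_DL2_sub_projR_DstarL2_single_le` with a free constant `Ck`), and a positive site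
weight whose far ratios grow slower than the kernel decays (`hwfar`, rate `ν < μ′`),
`|re⟪toL2(w(b₋)·X), B(toL2(w(b₋)⁻¹·X))⟫ − re⟪toL2 X, B(toL2 X)⟫| ≤ √2·Ck·θc·(d·(L^d)^{K−n}·(2(1+1∕(μ′−ν)))³)·‖toL2 X‖²` — Schur's test on the kernel `(w(bd₋)∕w(b₋) − 1)·k(bd,b)`;
at the pin `Ck = C·ℓ⁻³` the product `Ck·(L^d)^{K−n} = C` is K-FREE and the letter is `∝ θc`. [cite: Balaban1985BackgroundPropagators, Thm 3.1 (3.46) p.398, (3.49) p.399] -/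
theorem abs_re_inner_conj_kernel_sub_le (B : BondL2K ℂ 3 (periodsT3 F K) c₀ W₂ →ₗ[ℂ] BondL2K ℂ 3 (periodsT3 F K) c₀ W₂)
    (w : Site (F.P K) 0 → ℝ) {θc ν μ' Ck : ℝ} (hθc : 0 ≤ θc) (hCk : 0 ≤ Ck) (hνμ : ν < μ')
    (hwfar : ∀ x x' : Site (F.P K) 0, |w x / w x' - 1| ≤ θc * Real.exp (ν * (Site.tdist (P := F.P K) (iterBlockOf (K - n) x) (iterBlockOf (K - n) x') : ℝ)))
    (hk : ∀ (b : PBond (F.P K) 0) (Z : Matrix (Fin 2) (Fin 2) ℂ) (bd : PBond (F.P K) 0),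
      ‖(toL2 F K c₀).symm (B (toL2 F K c₀ (Pi.single b Z))) bd‖
        ≤ Ck * Real.exp (-(μ' * (Site.tdist (P := F.P K) (iterBlockOf (K - n) b.src) (iterBlockOf (K - n) bd.src) : ℝ))) * ‖Z‖)
    (X : PBond (F.P K) 0 → Matrix (Fin 2) (Fin 2) ℂ) :
    |RCLike.re ⟪toL2 F K c₀ (fun b => w b.src • X b), B (toL2 F K c₀ (fun b => (w b.src)⁻¹ • X b))⟫_ℂ - RCLike.re ⟪toL2 F K c₀ X, B (toL2 F K c₀ X)⟫_ℂ|
      ≤ Real.sqrt 2 * Ck * θc * (((F.P K).d : ℝ) * ((((F.P K).L : ℝ) ^ (F.P K).d) ^ (K - n)) * (2 * (1 + 1 / (μ' - ν))) ^ 3) * ‖toL2 F K c₀ X‖ ^ 2 := by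
  classical
  have hc₀ : 0 < c₀ := Fact.out
  have hμν : 0 < μ' - ν := sub_pos.mpr hνμ
  -- the kernel readback `k b Z bd := toL2⁻¹(B(toL2(δ_b ⊗ Z))) bd` and its expansion
  have hexp : ∀ (Y : PBond (F.P K) 0 → Matrix (Fin 2) (Fin 2) ℂ) (bd : PBond (F.P K) 0),
      (toL2 F K c₀).symm (B (toL2 F K c₀ Y)) bd = ∑ b, (toL2 F K c₀).symm (B (toL2 F K c₀ (Pi.single b (Y b)))) bd := by
    intro Y bd
    conv_lhs => rw [← Finset.univ_sum_single Y]
    rw [map_sum, map_sum, map_sum, Finset.sum_apply]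
  have hlin : ∀ (r : ℝ) (b : PBond (F.P K) 0) (Z : Matrix (Fin 2) (Fin 2) ℂ) (bd : PBond (F.P K) 0),
      (toL2 F K c₀).symm (B (toL2 F K c₀ (Pi.single b (r • Z)))) bd = (r : ℂ) • (toL2 F K c₀).symm (B (toL2 F K c₀ (Pi.single b Z))) bd := by
    intro r b Z bd
    rw [← Complex.coe_smul, Pi.single_smul, map_smul, map_smul, map_smul, Pi.smul_apply]
  -- both pairings as double sums of traces
  have hB : ∀ Y : PBond (F.P K) 0 → Matrix (Fin 2) (Fin 2) ℂ, B (toL2 F K c₀ Y) = toL2 F K c₀ ((toL2 F K c₀).symm (B (toL2 F K c₀ Y))) :=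
    fun Y => ((toL2 F K c₀).apply_symm_apply _).symm
  set kk : PBond (F.P K) 0 → PBond (F.P K) 0 → Matrix (Fin 2) (Fin 2) ℂ := fun bd b => (toL2 F K c₀).symm (B (toL2 F K c₀ (Pi.single b (X b)))) bd with hkk
  have hconj : ⟪toL2 F K c₀ (fun b => w b.src • X b), B (toL2 F K c₀ (fun b => (w b.src)⁻¹ • X b))⟫_ℂ
      = (c₀ : ℂ) * ∑ bd, ∑ b, (((w bd.src * (w b.src)⁻¹ : ℝ)) : ℂ) * Matrix.trace ((X bd).conjTranspose * kk bd b) := by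
    rw [hB, inner_toL2]
    congr 1
    refine Finset.sum_congr rfl fun bd _ => ?_
    rw [hexp, Matrix.mul_sum, Matrix.trace_sum]
    refine Finset.sum_congr rfl fun b _ => ?_
    rw [hlin, hkk, ← Complex.coe_smul, Matrix.conjTranspose_smul, Matrix.smul_mul, Matrix.mul_smul, Matrix.trace_smul, Matrix.trace_smul, smul_smul,
      Complex.star_def, Complex.conj_ofReal, smul_eq_mul]
    push_cast
    ring
  have hplain : ⟪toL2 F K c₀ X, B (toL2 F K c₀ X)⟫_ℂ = (c₀ : ℂ) * ∑ bd, ∑ b, Matrix.trace ((X bd).conjTranspose * kk bd b) := by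
    rw [hB, inner_toL2]
    congr 1
    refine Finset.sum_congr rfl fun bd _ => ?_
    rw [hexp, Matrix.mul_sum, Matrix.trace_sum]
  -- the difference
  have hdiff : ⟪toL2 F K c₀ (fun b => w b.src • X b), B (toL2 F K c₀ (fun b => (w b.src)⁻¹ • X b))⟫_ℂ - ⟪toL2 F K c₀ X, B (toL2 F K c₀ X)⟫_ℂ
      = (c₀ : ℂ) * ∑ bd, ∑ b, (((w bd.src / w b.src - 1 : ℝ)) : ℂ) * Matrix.trace ((X bd).conjTranspose * kk bd b) := by
    rw [hconj, hplain, ← mul_sub, ← Finset.sum_sub_distrib]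
    congr 1
    refine Finset.sum_congr rfl fun bd _ => ?_
    rw [← Finset.sum_sub_distrib]
    refine Finset.sum_congr rfl fun b _ => ?_
    rw [div_eq_mul_inv]
    push_cast
    ring
  -- entrywise bound
  set f : PBond (F.P K) 0 → ℝ := fun b => ‖(frobEquiv.symm (X b) : W₂)‖ with hf
  set Kf : PBond (F.P K) 0 → PBond (F.P K) 0 → ℝ := fun bd b =>
    Real.exp (-((μ' - ν) * (Site.tdist (P := F.P K) (iterBlockOf (K - n) bd.src) (iterBlockOf (K - n) b.src) : ℝ))) with hKf
  have hterm : ∀ bd b, ‖(((w bd.src / w b.src - 1 : ℝ)) : ℂ) * Matrix.trace ((X bd).conjTranspose * kk bd b)‖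
      ≤ Real.sqrt 2 * Ck * θc * (Kf bd b * (f bd * f b)) := by
    intro bd b
    rw [norm_mul, Complex.norm_real, Real.norm_eq_abs, ← Prop7SectET3HilbertLetters.inner_frobEquiv_symm]
    have h1 : ‖⟪(frobEquiv.symm (X bd) : W₂), frobEquiv.symm (kk bd b)⟫_ℂ‖ ≤ f bd * ‖(frobEquiv.symm (kk bd b) : W₂)‖ := norm_inner_le_norm _ _
    have h2 : ‖(frobEquiv.symm (kk bd b) : W₂)‖ ≤ Real.sqrt 2 * (Ck * Real.exp (-(μ' * (Site.tdist (P := F.P K) (iterBlockOf (K - n) b.src) (iterBlockOf (K - n) bd.src) : ℝ))) * f b) := by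
      refine (norm_frobEquiv_symm_le _).trans (mul_le_mul_of_nonneg_left ?_ (Real.sqrt_nonneg _))
      exact (hk b (X b) bd).trans (mul_le_mul_of_nonneg_left (norm_le_norm_frobEquiv_symm _) (by positivity))
    have h3 := hwfar bd.src b.src
    have hf0 : 0 ≤ f bd := norm_nonneg _
    have hfb : 0 ≤ f b := norm_nonneg _
    have hprod : |w bd.src / w b.src - 1| * ‖⟪(frobEquiv.symm (X bd) : W₂), frobEquiv.symm (kk bd b)⟫_ℂ‖
        ≤ (θc * Real.exp (ν * (Site.tdist (P := F.P K) (iterBlockOf (K - n) bd.src) (iterBlockOf (K - n) b.src) : ℝ)))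
          * (f bd * (Real.sqrt 2 * (Ck * Real.exp (-(μ' * (Site.tdist (P := F.P K) (iterBlockOf (K - n) b.src) (iterBlockOf (K - n) bd.src) : ℝ))) * f b))) :=
      mul_le_mul h3 (h1.trans (mul_le_mul_of_nonneg_left h2 hf0)) (by positivity) (by positivity)
    refine hprod.trans (le_of_eq ?_)
    rw [hKf, tdist_coarse_comm F (iterBlockOf (K - n) b.src)]
    simp only
    rw [show -((μ' - ν) * (Site.tdist (P := F.P K) (iterBlockOf (K - n) bd.src) (iterBlockOf (K - n) b.src) : ℝ))
        = ν * (Site.tdist (P := F.P K) (iterBlockOf (K - n) bd.src) (iterBlockOf (K - n) b.src) : ℝ)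
          + -(μ' * (Site.tdist (P := F.P K) (iterBlockOf (K - n) bd.src) (iterBlockOf (K - n) b.src) : ℝ)) by ring, Real.exp_add]
    ring
  -- Schur
  have hrow : ∀ bd, ∑ b, Kf bd b ≤ ((F.P K).d : ℝ) * ((((F.P K).L : ℝ) ^ (F.P K).d) ^ (K - n)) * (2 * (1 + 1 / (μ' - ν))) ^ 3 := fun bd => by
    rw [hKf]; exact sum_pbond_exp_neg_mul_tdist_le F hμν bd.src
  have hschur := sum_sum_mul_le_of_row_le Kf (fun _ _ => (Real.exp_pos _).le)
    (fun bd b => by rw [hKf]; simp only; rw [tdist_coarse_comm F]) hrow f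
  have hnormX : ‖toL2 F K c₀ X‖ ^ 2 = c₀ * ∑ b, f b ^ 2 := by
    rw [norm_sq_toL2]; congr 1; exact Finset.sum_congr rfl fun b _ => (norm_sq_frobEquiv_symm (X b)).symm
  -- assemble
  rw [← map_sub, hdiff]
  calc |RCLike.re ((c₀ : ℂ) * ∑ bd, ∑ b, (((w bd.src / w b.src - 1 : ℝ)) : ℂ) * Matrix.trace ((X bd).conjTranspose * kk bd b))|
      ≤ ‖(c₀ : ℂ) * ∑ bd, ∑ b, (((w bd.src / w b.src - 1 : ℝ)) : ℂ) * Matrix.trace ((X bd).conjTranspose * kk bd b)‖ := RCLike.abs_re_le_norm _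
    _ ≤ c₀ * ∑ bd, ∑ b, Real.sqrt 2 * Ck * θc * (Kf bd b * (f bd * f b)) := by
        rw [norm_mul, Complex.norm_real, Real.norm_of_nonneg hc₀.le]
        refine mul_le_mul_of_nonneg_left ((norm_sum_le _ _).trans (Finset.sum_le_sum fun bd _ => (norm_sum_le _ _).trans (Finset.sum_le_sum fun b _ => hterm bd b))) hc₀.le
    _ = Real.sqrt 2 * Ck * θc * (c₀ * ∑ bd, ∑ b, Kf bd b * (f bd * f b)) := by
        rw [Finset.mul_sum, Finset.mul_sum, Finset.mul_sum]
        refine Finset.sum_congr rfl fun bd _ => ?_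
        rw [Finset.mul_sum, Finset.mul_sum, Finset.mul_sum]
        exact Finset.sum_congr rfl fun b _ => by ring
    _ ≤ Real.sqrt 2 * Ck * θc * (c₀ * ((((F.P K).d : ℝ) * ((((F.P K).L : ℝ) ^ (F.P K).d) ^ (K - n)) * (2 * (1 + 1 / (μ' - ν))) ^ 3) * ∑ b, f b ^ 2)) :=
        mul_le_mul_of_nonneg_left (mul_le_mul_of_nonneg_left hschur hc₀.le) (by positivity)
    _ = Real.sqrt 2 * Ck * θc * (((F.P K).d : ℝ) * ((((F.P K).L : ℝ) ^ (F.P K).d) ^ (K - n)) * (2 * (1 + 1 / (μ' - ν))) ^ 3) * ‖toL2 F K c₀ X‖ ^ 2 := by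
        rw [hnormX]; ring

end Schur

end Summit.QuantumFields.YangMills.Theorems.Prop7OneFormAgmonLetters

end
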